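import Summits.KontsevichZagierPeriods.KontsevichZagierPeriods.Theorems.GrothendieckSectorComplementRingJoin
-- (the a1 landings `stub_ringJoinKPi` / `ringJoinEPi` live in
--  `…Theorems.GrothendieckSectorComplementStubRingJoinKPi` (p112506, p112716); not imported here only so that this
--  workfile elaborates while the farm rebuilds that module — nothing below depends on it)

/-!
# Line `containment-join` (ring level) for crux `Grothendieck.SectorComplement`
# (stmt-KontsevichZagierPeriods-11102) — LEAD SKELETON v4 (re-seat a1; FINAL: every buildable stub LANDED)

v4 (lead a1, 2026-08-16): the line is fully built. All stubs of v3 except the declared remainder are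
now TREE THEOREMS and are IMPORTED here instead of being restated:

* S1 `stub_saturationKernel` — p99032 (`…StubSaturationKernel.lean`);
* S2c `stub_piLineKernel` — p100184; S2ab `stub_wordClass` — p102904; S2 glue `piRootRing` — p105421
  (`GrothendieckSectorComplementRingJoin.lean`, UNCONDITIONAL π-root ring through weight 4);
* S3a `stub_lemRingKernel` — p101354; S3 `stub_ringJoin` — p105421 (ring join given `H₁`);
* S3b `stub_ringJoinKPi` — p112506 (`GrothendieckSectorComplementStubRingJoinKPi.lean`, UNCONDITIONAL
  `(K(1/√2), π)`-root ring, via the new `kPiAlgIndependent`), and its sequel `ringJoinEPi` — p112716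
  (UNCONDITIONAL `(E(1/√2), π)`-root ring, `ePiAlgIndependent`): every PAIR from `{κ, ε, ϖ}` roots an
  unconditional sector joined with the MZV word classes of weights 2, 4; only the TRIPLE needs `H₁`;
* read-back `ringRemainder_iff_crux`, `lsk_iff_ringJoinKernel` — p105421.

What remains is the single registered stub `stub_ringRemainder`, the line's DECLARED REMAINDER, which is
PROVED EQUIVALENT TO THE CRUX (`ringRemainder_iff_crux`) — i.e. to
`GpcLegendreLemniscatic → KontsevichZagierPeriods` (Cruxes/SectorComplement/Strategist.lean
`crux_iff_legendre_imp`): Conjecture 1 of Kontsevich–Zagier for all pairs, given one Legendre chain.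
Nobody is briefed on it (summit strength; STRATEGY-CENSUS.md: no strategy short of the summit).

Composition in the formal period ring `P = FormalRep ⧸ relations`: `H₁` ⟹ ring join (`stub_ringJoin`,
landed) ⟹ (declared remainder) Statement; `H₂ = GpcZeta4Eq4zeta31` is idle (tree theorem
`gpcZeta4Eq4zeta31_proof`).
-/

noncomputable section

open MeasureTheory Set
open Literature.NumberTheory.Transcendental
open Literature.NumberTheory.Transcendental.KZ
open MvPolynomial (aeval X C)
open Summit.KontsevichZagierPeriods.KontsevichZagierPeriods.Theses.Grothendieck
open Summit.KontsevichZagierPeriods.Grothendieck.GpcLegendreLemniscaticNegative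
open Summit.KontsevichZagierPeriods.Grothendieck.LemniscaticSectorGlue
open Summit.KontsevichZagierPeriods.Grothendieck.SectorComplementAmalgamation
open Summit.KontsevichZagierPeriods.MzvKernelInKZ.Negative

namespace Summit.KontsevichZagierPeriods.Grothendieck.SectorComplementRingJoin

/-! ## §1–§3b LANDED (imported): `stub_saturationKernel`, `stub_piLineKernel`, `stub_wordClass`,
`piRootRing`, `stub_lemRingKernel`, `stub_ringJoin`, `stub_ringJoinKPi`, `ringJoinEPi` -/

-- the landed stubs, by name (elaboration checks they exist with the registered signatures)
example : LemniscaticSectorKernel →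
    ∀ (p : IntegralRep 1), p.domain = Set.univ → (p.integrand = fun x => 1 / (1 + x 0 ^ 2)) →
      ∀ x ∈ Subring.closure
          ({toFormalPeriod (of kRep), toFormalPeriod (of eRep), toFormalPeriod (of p)} ∪
            toFormalPeriod '' (genSetAdm 2 ∪ genSetAdm 4)),
        evalP x = 0 → x = 0 := stub_ringJoin

-- `stub_ringJoinKPi` (the `(κ, ϖ)`-root, p112506) and `ringJoinEPi` (the `(ε, ϖ)`-root, p112716) are landed in
-- `Theorems/GrothendieckSectorComplementStubRingJoinKPi.lean` with exactly the registered signature of v3's S3b.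

example : ∀ (p : IntegralRep 1), p.domain = Set.univ → (p.integrand = fun x => 1 / (1 + x 0 ^ 2)) →
    ∀ x ∈ Subring.closure ({toFormalPeriod (of p)} ∪ toFormalPeriod '' (genSetAdm 2 ∪ genSetAdm 4)),
      evalP x = 0 → x = 0 := piRootRing

/-! ## §4 The declared remainder (registered stub S4, summit-strength, NOT CLAIMED) -/

/-- STUB S4 (registered `stub_ringRemainder`, DECLARED REMAINDER): Conjecture 1 off the ring join —
injectivity of `evalP` on the ring join implies the Statement. Summit-strength: PROVED equivalent to
the crux (`ringRemainder_iff_crux`, landed p105421), i.e. to `GpcLegendreLemniscatic →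
KontsevichZagierPeriods`; nobody is expected to prove it. -/
theorem stub_ringRemainder :
    (∀ (p : IntegralRep 1), p.domain = Set.univ → (p.integrand = fun x => 1 / (1 + x 0 ^ 2)) →
      ∀ x ∈ Subring.closure
          ({toFormalPeriod (of kRep), toFormalPeriod (of eRep), toFormalPeriod (of p)} ∪
            toFormalPeriod '' (genSetAdm 2 ∪ genSetAdm 4)),
        evalP x = 0 → x = 0) →
      KontsevichZagierPeriods := by
  sorry

/-! ## §5 Composition -/

/-- **The crux by name, modulo the one remaining stub**: `H₁` gives the ring join (`stub_ringJoin`,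
landed) and the declared remainder concludes the Statement; `H₂` is idle. -/
theorem SectorComplement_of : SectorComplement := fun h1 _ =>
  stub_ringRemainder (stub_ringJoin h1)

/-! ## §6 Read-back (landed): the remainder is EXACTLY the crux -/

example :
    ((∀ (p : IntegralRep 1), p.domain = Set.univ → (p.integrand = fun x => 1 / (1 + x 0 ^ 2)) →
      ∀ x ∈ Subring.closure
          ({toFormalPeriod (of kRep), toFormalPeriod (of eRep), toFormalPeriod (of p)} ∪
            toFormalPeriod '' (genSetAdm 2 ∪ genSetAdm 4)),
        evalP x = 0 → x = 0) → KontsevichZagierPeriods) ↔ SectorComplement :=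
  ringRemainder_iff_crux

end Summit.KontsevichZagierPeriods.Grothendieck.SectorComplementRingJoin

end
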